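import Summits.CriticalPhenomena.SAWScalingLimit.Theses.SAWRestrictionRigidity
import Summits.CriticalPhenomena.SAWScalingLimit.Theses.SAWRestrictionDescent
import Summits.CriticalPhenomena.SAWScalingLimit.Theorems.SAWRestrictionRigidityRigidityIffRepairAndRado
import Literature.Probability.RandomPlanarGeometry.ConformalRestrictionCovariance
import Literature.Probability.RandomPlanarGeometry.ConformalRestrictionHolds
import Literature.Probability.RandomPlanarGeometry.RadoContinuity
import Literature.Probability.RandomPlanarGeometry.LoopSpaceMaps

/-!
# The repaired crux `Rigidity` (C′) is a corollary of route SAWRestrictionDescent's `TopTriv ∧ TopRes`, and conversely gives `TopTriv` on Radó-continuous families — crux stmt-CriticalPhenomena-1368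

Target: `Summits/CriticalPhenomena/SAWScalingLimit/Theorems/SAWRestrictionRigidityRigidityRepairOfDescent.lean`
(`--supports stmt-CriticalPhenomena-1368`; lead c5 of line `registered`, 2026-08-17).

Three consecutive line leads (c3, c4, c5) return `verdict: misstated` on the crux `Rigidity`
(stmt-CriticalPhenomena-1368, routes SAWRestrictionRigidity r2 / SAWZoomRigidity r3) AS TYPED and
recommend the restatement C′ = "the seven lattice-exact axioms AND Radó continuity of `D ↦ P D`
imply conformal covariance" (crux workfile `Cruxes/Rigidity/Repair.lean`, `RigidityC`; kernel-checked
split `rigidity_iff_repair_and_rado : Rigidity ↔ C′ ∧ AxiomsForceRado`,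
`Theorems/SAWRestrictionRigidityRigidityIffRepairAndRado.lean`).

This file is the kernel-checked MERGE CERTIFICATE that goes with that verdict. Route
SAWRestrictionDescent already types the "with continuity" world as two cruxes, `TopTriv`
(stmt-CriticalPhenomena-8478: the axioms force a topological copy of SLE(8/3) in every domain) and
`TopRes` (stmt-CriticalPhenomena-8479: restriction–Markov + reversal + `z ↦ iᵏ z + w` covariance +
Radó continuity + topologically-SLE in one domain ⇒ SLE(8/3) there). We prove, by pure logic over the
tree's packaged vocabulary (each notion definitionally the clause inlined in the route files):

* `repair_of_topTriv_topRes : TopTriv → TopRes → C′` — the repaired crux is a COROLLARY of the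
  descent route's two cruxes (the SLE(8/3) family is conformally covariant:
  `ChordalFamily.isConformallyCovariant_of_isSLELaw`);
* `rigidity_of_topTriv_topRes_of_forceRado : TopTriv → TopRes → AxiomsForceRado → Rigidity` — hence
  the crux AS TYPED follows from the two descent cruxes plus the SAW-free regularity statement
  `AxiomsForceRado` (second conjunct of `rigidity_iff_repair_and_rado`), and from nothing less on the
  regularity side (`rado_of_rigidity`);
* `topTriv_conclusion_of_repair : C′ → (TopTriv's conclusion for every Radó-continuous family with
  the axioms and two-sided restriction)` — by LSW03 at κ = 8/3, PROVED in the tree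
  (`LawlerSchrammWerner2003_holds`), with the trivial topological copy `F = id`.

So, modulo `TopRes` and on Radó-continuous families, C′ and `TopTriv` are the SAME open problem
(LSW04 §3.4.5); the planner can let route SAWRestrictionRigidity want {stmt-8478, stmt-8479,
stmt-7305} in place of a restated stmt-1368, or restate stmt-1368 as C′ and record that
stmt-8478 ∧ stmt-8479 close it (`repair_of_topTriv_topRes`). No new mathematics is claimed here.
-/

namespace Summit.CriticalPhenomena.SAWScalingLimit.Cruxes.Rigidity.Repair

open MeasureTheory
open Literature.Probability.RandomPlanarGeometry
open Summit.CriticalPhenomena.SAWScalingLimit.Theses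

/-- **`TopTriv ∧ TopRes ⇒ every axioms family that is Radó-continuous is chordal SLE(8/3) in every domain.** From `TopTriv` (stmt-CriticalPhenomena-8478) the family is a topological copy of SLE(8/3) in every marked domain; `TopRes` (stmt-CriticalPhenomena-8479), fed the `r = 1` sub-case of the lattice-similarity clause and the Radó clause, upgrades the copy to the SLE(8/3) law itself. Pure logic over the packaged axioms (`IsRestrictionMarkov`, `IsReversible`, `IsLatticeSimilarityCovariant`, `IsCarriedBySimpleCurves`, `IsRadoContinuous`, each definitionally the inlined clause). [folklore] -/
theorem isSLELaw_of_topTriv_topRes (hT : SAWRestrictionDescent.TopTriv) (hR : SAWRestrictionDescent.TopRes)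
    (P : ChordalFamily) (hch : P.IsChordal) (hRM : P.IsRestrictionMarkov) (hrev : P.IsReversible)
    (hLS : P.IsLatticeSimilarityCovariant) (hS : P.IsCarriedBySimpleCurves) (hRado : P.IsRadoContinuous) :
    ∀ D : DobrushinDomain, IsSLELaw ((8 : NNReal) / 3) D (P D) := by
  intro D
  have hquarter : ∀ (D : DobrushinDomain) (c : ℂ) (hc : c ≠ 0) (w : ℂ), (∃ k : ℕ, c = Complex.I ^ k) →
      P (D.map (similarity c hc w)) = (P D).map (CurveClass.map (similarity c hc w : C(ℂ, ℂ))) := by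
    intro D c hc w hk
    obtain ⟨k, hk⟩ := hk
    exact hLS.1 D c hc w ⟨1, k, one_pos, by simp [hk]⟩
  exact hR P hch hRM hrev hquarter hRado D (hT P hch hRM hrev hLS hS D)

/-- **Merge certificate, forward direction: the repaired crux C′ is a corollary of `TopTriv ∧ TopRes`.** With the two cruxes of route SAWRestrictionDescent (stmt-CriticalPhenomena-8478, stmt-CriticalPhenomena-8479), every chordal family with the seven lattice-exact axioms of `Rigidity` that is Radó-continuous is SLE(8/3) in every domain (`isSLELaw_of_topTriv_topRes`), hence conformally covariant (`ChordalFamily.isConformallyCovariant_of_isSLELaw`, Lawler 2005 §6.1). The conclusion is VERBATIM the first conjunct (C′, packaged form of `Cruxes/Rigidity/Repair.lean`'s `RigidityC`) of `rigidity_iff_repair_and_rado`. [folklore] -/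
theorem repair_of_topTriv_topRes : Summit.CriticalPhenomena.SAWScalingLimit.Theses.SAWRestrictionDescent.TopTriv → Summit.CriticalPhenomena.SAWScalingLimit.Theses.SAWRestrictionDescent.TopRes → ∀ P : Literature.Probability.RandomPlanarGeometry.ChordalFamily, P.IsChordal → P.IsRestriction → P.IsRestrictionMarkov → P.IsReversible → P.IsLatticeSimilarityCovariant → P.IsCarriedBySimpleCurves → P.IsRadoContinuous → P.IsConformallyCovariant := by
  intro hT hR P hch _hres hRM hrev hLS hS hRado
  exact ChordalFamily.isConformallyCovariant_of_isSLELaw (isSLELaw_of_topTriv_topRes hT hR P hch hRM hrev hLS hS hRado)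

/-- **The crux AS TYPED from the descent cruxes plus the SAW-free regularity statement.** `TopTriv → TopRes → AxiomsForceRado → Rigidity`, where `AxiomsForceRado` ("every chordal family with the seven axioms is Radó-continuous") is the second conjunct of `rigidity_iff_repair_and_rado` — and by `rado_of_rigidity` nothing weaker on the regularity side can do, since `Rigidity` itself implies `AxiomsForceRado`. This is the precise sense in which stmt-CriticalPhenomena-1368 as typed = (stmt-8478 ∧ stmt-8479)-type mathematics + a regularity statement irrelevant to the self-avoiding walk. [folklore] -/
theorem rigidity_of_topTriv_topRes_of_forceRado (hT : SAWRestrictionDescent.TopTriv) (hR : SAWRestrictionDescent.TopRes)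
    (hRado : ∀ P : Literature.Probability.RandomPlanarGeometry.ChordalFamily, P.IsChordal → P.IsRestriction → P.IsRestrictionMarkov → P.IsReversible → P.IsLatticeSimilarityCovariant → P.IsCarriedBySimpleCurves → P.IsRadoContinuous) :
    Summit.CriticalPhenomena.SAWScalingLimit.Theses.SAWRestrictionRigidity.Rigidity :=
  rigidity_iff_repair_and_rado.2 ⟨repair_of_topTriv_topRes hT hR, hRado⟩

/-- **Merge certificate, backward direction: C′ gives `TopTriv`'s conclusion on every Radó-continuous axioms family with two-sided restriction.** From C′ the family is conformally covariant; LSW03 at κ = 8/3, PROVED in the tree (`LawlerSchrammWerner2003_holds`: chordal + conformally covariant + restriction + simple boundary-avoiding ⇒ SLE(8/3) in every domain), identifies every `P D`; the topological copy is then the trivial one, `F = id`, `μ = P D`. So modulo `TopRes`, and on Radó-continuous families (the only ones a SAW limit with `ContinuityOfLimit`, stmt-7305, can be), the repaired stmt-1368 and stmt-8478 are one open problem (LSW04 §3.4.5), not two. [folklore] -/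
theorem topTriv_conclusion_of_repair
    (hC : ∀ P : Literature.Probability.RandomPlanarGeometry.ChordalFamily, P.IsChordal → P.IsRestriction → P.IsRestrictionMarkov → P.IsReversible → P.IsLatticeSimilarityCovariant → P.IsCarriedBySimpleCurves → P.IsRadoContinuous → P.IsConformallyCovariant) :
    ∀ P : Literature.Probability.RandomPlanarGeometry.ChordalFamily, P.IsChordal → P.IsRestriction → P.IsRestrictionMarkov → P.IsReversible → P.IsLatticeSimilarityCovariant → P.IsCarriedBySimpleCurves → P.IsRadoContinuous → ∀ D : Literature.Probability.RandomPlanarGeometry.DobrushinDomain, ∃ (F : C(ℂ, ℂ)) (μ : MeasureTheory.Measure (Literature.Probability.RandomPlanarGeometry.CurveClass ℂ)), Set.InjOn F (closure D.carrier) ∧ F '' D.carrier = D.carrier ∧ F (D.pt 0) = D.pt 0 ∧ F (D.pt 1) = D.pt 1 ∧ Literature.Probability.RandomPlanarGeometry.IsSLELaw ((8 : NNReal) / 3) D μ ∧ P D = μ.map (Literature.Probability.RandomPlanarGeometry.CurveClass.map F) := by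
  intro P hch hres hRM hrev hLS hS hRado D
  have hcov : P.IsConformallyCovariant := hC P hch hres hRM hrev hLS hS hRado
  have hsle : ∀ D : DobrushinDomain, IsSLELaw ((8 : NNReal) / 3) D (P D) :=
    LawlerSchrammWerner2003_holds P hch hcov hres hS
  refine ⟨ContinuousMap.id ℂ, P D, Set.injOn_id _, by simp, rfl, rfl, hsle D, ?_⟩
  have hid : (CurveClass.map (ContinuousMap.id ℂ) : CurveClass ℂ → CurveClass ℂ) = id := by
    funext c
    exact CurveClass.map_id c
  rw [hid, Measure.map_id]

/-- **Summary equivalence (modulo `TopRes`, on Radó-continuous restriction families): C′ ↔ TopTriv|Radó.** Given `TopRes` (stmt-CriticalPhenomena-8479), the repaired crux C′ of stmt-CriticalPhenomena-1368 is EQUIVALENT to `TopTriv` (stmt-CriticalPhenomena-8478) restricted to Radó-continuous families with two-sided restriction — forward by `topTriv_conclusion_of_repair` (LSW03, proved), backward by `TopRes` and conformal covariance of SLE(8/3). [folklore] -/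
theorem repair_iff_topTrivOnRado_of_topRes (hR : SAWRestrictionDescent.TopRes) :
    (∀ P : Literature.Probability.RandomPlanarGeometry.ChordalFamily, P.IsChordal → P.IsRestriction → P.IsRestrictionMarkov → P.IsReversible → P.IsLatticeSimilarityCovariant → P.IsCarriedBySimpleCurves → P.IsRadoContinuous → P.IsConformallyCovariant) ↔
    (∀ P : Literature.Probability.RandomPlanarGeometry.ChordalFamily, P.IsChordal → P.IsRestriction → P.IsRestrictionMarkov → P.IsReversible → P.IsLatticeSimilarityCovariant → P.IsCarriedBySimpleCurves → P.IsRadoContinuous → ∀ D : Literature.Probability.RandomPlanarGeometry.DobrushinDomain, ∃ (F : C(ℂ, ℂ)) (μ : MeasureTheory.Measure (Literature.Probability.RandomPlanarGeometry.CurveClass ℂ)), Set.InjOn F (closure D.carrier) ∧ F '' D.carrier = D.carrier ∧ F (D.pt 0) = D.pt 0 ∧ F (D.pt 1) = D.pt 1 ∧ Literature.Probability.RandomPlanarGeometry.IsSLELaw ((8 : NNReal) / 3) D μ ∧ P D = μ.map (Literature.Probability.RandomPlanarGeometry.CurveClass.map F)) := by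
  refine ⟨topTriv_conclusion_of_repair, fun hT P hch _hres hRM hrev hLS hS hRado => ?_⟩
  have hquarter : ∀ (D : DobrushinDomain) (c : ℂ) (hc : c ≠ 0) (w : ℂ), (∃ k : ℕ, c = Complex.I ^ k) →
      P (D.map (similarity c hc w)) = (P D).map (CurveClass.map (similarity c hc w : C(ℂ, ℂ))) := by
    intro D c hc w hk
    obtain ⟨k, hk⟩ := hk
    exact hLS.1 D c hc w ⟨1, k, one_pos, by simp [hk]⟩
  exact ChordalFamily.isConformallyCovariant_of_isSLELaw fun D =>
    hR P hch hRM hrev hquarter hRado D (hT P hch _hres hRM hrev hLS hS hRado D)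

end Summit.CriticalPhenomena.SAWScalingLimit.Cruxes.Rigidity.Repair
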